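import Summits.NavierStokesRegularity.NavierStokesRegularity.Theses.FilamentSkeletonRss
import Literature.Analysis.FluidPDE.AncientMildDrift

/-!
# `RdssProfileTruncation` (stmt-NavierStokesRegularity-11289): the PDE clause and nontriviality are load-bearing

Negative-side support for crux `RdssProfileTruncation` of routes `FilamentSkeletonRss` (#4) and
`CorkscrewDynamo` (#3) (cdisprove seat, cycle 1, 2026-08-16; crux workfile
`Cruxes/RdssProfileTruncation/Disproof.lean`).  The antecedent of the bridge is
"`1 < c`, ancient mild solution, measurable slices, `(c,R)`-RDSS, Type-I, not a.e. zero".  Two of its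
clauses are shown load-bearing by explicit KINEMATIC inhabitants of the antecedent with the clause
deleted, so that the correspondingly weakened bridge is equivalent to its own conclusion X5a (the open
blow-up problem):

* `rdssProfileTruncation_withoutMild_antecedent_inhabited` / `rdssProfileTruncation_withoutMild_iff`
  — delete `IsAncientMildSolution 1 u`: the Type-I cone field `u(t,x) = (‖x‖ + √(−t))⁻¹ e₀` is
  `(2, id)`-RDSS, Type-I with `C₀ = 1` (equality), continuous hence measurable on every slice
  `t < 0`, and nonzero;
* `rdssProfileTruncation_withoutNontrivial_antecedent_inhabited` /
  `rdssProfileTruncation_withoutNontrivial_iff` — delete `¬ (∀ t < 0, u t =ᵐ 0)`: `u ≡ 0` (an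
  ancient mild solution by the in-tree `isAncientMildSolution_timeConst`).

So the bridge's content is entirely in the PDE + nontriviality acting TOGETHER with the symmetry and
the Type-I bound (for the Type-I clause see `TimeDecayOnlyCollapse.lean`).
-/

set_option linter.dupNamespace false

noncomputable section

namespace Summit.NavierStokesRegularity.NavierStokesRegularity.Theorems.RdssProfileTruncation.Negative

open Literature.Analysis.FluidPDE MeasureTheory

/-- **The Type-I cone field inhabits the antecedent minus the PDE.**  Witness `c = 2`, `R = id`,
`u(t,x) = (‖x‖ + √(−t))⁻¹ e₀`. [folklore] -/
theorem rdssProfileTruncation_withoutMild_antecedent_inhabited :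
    ∃ (c : ℝ) (R : (EuclideanSpace ℝ (Fin 3)) ≃ₗᵢ[ℝ] (EuclideanSpace ℝ (Fin 3)))
      (u : ℝ → (EuclideanSpace ℝ (Fin 3)) → (EuclideanSpace ℝ (Fin 3))), 1 < c ∧
      (∀ t < 0, AEStronglyMeasurable (u t) volume) ∧ IsRotatedDSS c R u ∧
      (∃ C₀ : ℝ, HasTypeIDecay C₀ u) ∧ ¬ (∀ t < 0, u t =ᵐ[volume] 0) := by
  set e₀ : EuclideanSpace ℝ (Fin 3) := EuclideanSpace.single 0 1 with he₀
  have hne : ‖e₀‖ = 1 := by simp [he₀]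
  have he0 : e₀ ≠ 0 := by
    intro h; rw [h, norm_zero] at hne; exact zero_ne_one hne
  have hsqrt : ∀ t : ℝ, Real.sqrt (-((2 : ℝ) ^ 2 * t)) = 2 * Real.sqrt (-t) := fun t => by
    rw [show -((2 : ℝ) ^ 2 * t) = 2 ^ 2 * (-t) by ring, Real.sqrt_mul (by norm_num) (-t),
      Real.sqrt_sq (by norm_num)]
  have hden : ∀ t < (0 : ℝ), ∀ x : EuclideanSpace ℝ (Fin 3), 0 < ‖x‖ + Real.sqrt (-t) :=
    fun t ht x => add_pos_of_nonneg_of_pos (norm_nonneg _) (Real.sqrt_pos.2 (by linarith))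
  have hcont : ∀ t < (0 : ℝ), Continuous fun x : EuclideanSpace ℝ (Fin 3) =>
      (‖x‖ + Real.sqrt (-t))⁻¹ • e₀ := fun t ht =>
    ((continuous_norm.add continuous_const).inv₀ fun x => (hden t ht x).ne').smul continuous_const
  refine ⟨2, LinearIsometryEquiv.refl ℝ _, fun t x => (‖x‖ + Real.sqrt (-t))⁻¹ • e₀, one_lt_two,
    fun t ht => (hcont t ht).aestronglyMeasurable, fun t x => ?_, ⟨1, fun t ht x => ?_⟩, ?_⟩
  · -- `(2, id)`-RDSS (all `t`; both sides are `0` in the junk region)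
    simp only [show (LinearIsometryEquiv.refl ℝ (EuclideanSpace ℝ (Fin 3))).symm =
        LinearIsometryEquiv.refl ℝ _ from rfl, LinearIsometryEquiv.coe_refl, id_eq, hsqrt, norm_smul,
      Real.norm_of_nonneg (show (0 : ℝ) ≤ 2 by norm_num), ← mul_add, mul_inv]
    module
  · -- Type-I with constant `1` (equality)
    simp only [norm_smul, norm_inv, Real.norm_of_nonneg (hden t ht x).le, hne, mul_one, one_div, le_refl]
  · -- nonzero on the slice `t = -1`
    intro h
    have heq := (Continuous.ae_eq_iff_eq volume (hcont (-1) (by norm_num)) continuous_const).1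
      (h (-1) (by norm_num))
    have := congr_fun heq 0
    simp [he0] at this

/-- **Deleting the PDE collapses the bridge to the blow-up problem X5a itself** (the conclusion is
`RdssProfileTruncation`'s, verbatim). [folklore] -/
theorem rdssProfileTruncation_withoutMild_iff :
    ((∃ (c : ℝ) (R : (EuclideanSpace ℝ (Fin 3)) ≃ₗᵢ[ℝ] (EuclideanSpace ℝ (Fin 3)))
        (u : ℝ → (EuclideanSpace ℝ (Fin 3)) → (EuclideanSpace ℝ (Fin 3))), 1 < c ∧
        (∀ t < 0, AEStronglyMeasurable (u t) volume) ∧ IsRotatedDSS c R u ∧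
        (∃ C₀ : ℝ, HasTypeIDecay C₀ u) ∧ ¬ (∀ t < 0, u t =ᵐ[volume] 0)) →
      ∃ ν : ℝ, 0 < ν ∧ ∃ T : ℝ, 0 < T ∧ ∃ (u : ℝ → (EuclideanSpace ℝ (Fin 3)) → (EuclideanSpace ℝ (Fin 3)))
        (p : ℝ → (EuclideanSpace ℝ (Fin 3)) → ℝ),
        IsMaximalSmoothSolution ν 0 u p T ∧ IsLerayHopfOn T ν 0 (u 0) u ∧
        HasRapidSpatialDecay (u 0)) ↔
    ∃ ν : ℝ, 0 < ν ∧ ∃ T : ℝ, 0 < T ∧ ∃ (u : ℝ → (EuclideanSpace ℝ (Fin 3)) → (EuclideanSpace ℝ (Fin 3)))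
      (p : ℝ → (EuclideanSpace ℝ (Fin 3)) → ℝ),
      IsMaximalSmoothSolution ν 0 u p T ∧ IsLerayHopfOn T ν 0 (u 0) u ∧
      HasRapidSpatialDecay (u 0) :=
  ⟨fun h => h rdssProfileTruncation_withoutMild_antecedent_inhabited, fun h _ => h⟩

/-- **`u ≡ 0` inhabits the antecedent minus nontriviality** (`c = 2`, `R = id`, `C₀ = 0`).
[folklore] -/
theorem rdssProfileTruncation_withoutNontrivial_antecedent_inhabited :
    ∃ (c : ℝ) (R : (EuclideanSpace ℝ (Fin 3)) ≃ₗᵢ[ℝ] (EuclideanSpace ℝ (Fin 3)))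
      (u : ℝ → (EuclideanSpace ℝ (Fin 3)) → (EuclideanSpace ℝ (Fin 3))), 1 < c ∧ IsAncientMildSolution 1 u ∧
      (∀ t < 0, AEStronglyMeasurable (u t) volume) ∧ IsRotatedDSS c R u ∧
      (∃ C₀ : ℝ, HasTypeIDecay C₀ u) :=
  ⟨2, LinearIsometryEquiv.refl ℝ _, fun _ _ => 0, one_lt_two,
    isAncientMildSolution_timeConst 1 fun _ => (0 : EuclideanSpace ℝ (Fin 3)),
    fun _ _ => aestronglyMeasurable_const, fun t x => by simp, ⟨0, fun t _ x => by simp⟩⟩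

/-- **Deleting nontriviality collapses the bridge to X5a.** [folklore] -/
theorem rdssProfileTruncation_withoutNontrivial_iff :
    ((∃ (c : ℝ) (R : (EuclideanSpace ℝ (Fin 3)) ≃ₗᵢ[ℝ] (EuclideanSpace ℝ (Fin 3)))
        (u : ℝ → (EuclideanSpace ℝ (Fin 3)) → (EuclideanSpace ℝ (Fin 3))), 1 < c ∧ IsAncientMildSolution 1 u ∧
        (∀ t < 0, AEStronglyMeasurable (u t) volume) ∧ IsRotatedDSS c R u ∧
        (∃ C₀ : ℝ, HasTypeIDecay C₀ u)) →
      ∃ ν : ℝ, 0 < ν ∧ ∃ T : ℝ, 0 < T ∧ ∃ (u : ℝ → (EuclideanSpace ℝ (Fin 3)) → (EuclideanSpace ℝ (Fin 3)))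
        (p : ℝ → (EuclideanSpace ℝ (Fin 3)) → ℝ),
        IsMaximalSmoothSolution ν 0 u p T ∧ IsLerayHopfOn T ν 0 (u 0) u ∧
        HasRapidSpatialDecay (u 0)) ↔
    ∃ ν : ℝ, 0 < ν ∧ ∃ T : ℝ, 0 < T ∧ ∃ (u : ℝ → (EuclideanSpace ℝ (Fin 3)) → (EuclideanSpace ℝ (Fin 3)))
      (p : ℝ → (EuclideanSpace ℝ (Fin 3)) → ℝ),
      IsMaximalSmoothSolution ν 0 u p T ∧ IsLerayHopfOn T ν 0 (u 0) u ∧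
      HasRapidSpatialDecay (u 0) :=
  ⟨fun h => h rdssProfileTruncation_withoutNontrivial_antecedent_inhabited, fun h _ => h⟩

end Summit.NavierStokesRegularity.NavierStokesRegularity.Theorems.RdssProfileTruncation.Negative
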